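import Summits.AtomisticToContinuum.Crystallization.Theorems.ExcessDecayLiouvilleHcpLiouvillePairCalculus
import Summits.AtomisticToContinuum.Crystallization.Theorems.ExcessDecayLiouvilleHcpLiouvilleSiteSums

/-!
# `ExcessDecayLiouville.HcpLiouville` (stmt-AtomisticToContinuum-9332), line `Sketch`: chord coercivity, integrated

Step (3) of stub `stub_flatDifferences` (level 2 of the two-level Caccioppoli argument).  Data: an
admissible hcp datum (`Adm₀ A`, `Inner₀ t A`), two displacements `u`, `u₁` of the sites `S = Sites₀ t A`
bounded by `1/40`, a centre `c` and a radius `R > 0`; write `w = u₁ − u`, `χ` for the radial cut-off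
`max 0 (min 1 (2 − dist · c / R))`, `φ = χ·w` (test field, finitely supported on `S`), and for sites
`p ≠ q`: `a_pq = p + u p − (q + u q)` (bond of the first configuration), `δ_pq = w p − w q` (chord
direction; `a_pq + δ_pq` is the bond of the second configuration).

* `chord_dist_le` : the chord `a_pq + θδ_pq`, `θ ∈ [0,1]`, stays at norm `≥ (9/10) dist p q`;
* `summable_chordBound` : the dominating family `904(10/9)⁸ (dist p q)⁻⁸ ‖φ p − φ q‖²` is summable
  over `↥S × ↥S`;
* `hasSum_secForm` : dominated convergence — the family of secant forms
  `secHess a_pq δ_pq (φ p − φ q)` has sum `∫₀¹ (Σ_{(p,q)} Hess₀ (a_pq + θδ_pq) (φ p − φ q)) dθ`;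
* `flatDiff_coercive_integrated` : if `BoxCoercive (1/40) κ₁`, then — the configuration `u + θw` being in the
  `1/40`-box for every `θ ∈ [0,1]` — integrating the box inequality over `θ` gives
  `2κ₁ · nnForm t A φ ≤ Σ_{(p,q)} secHess a_pq δ_pq (φ p − φ q)`.

All `[folklore]`; a `--supports` helper for item stmt-AtomisticToContinuum-9332, nothing here closes an
item.
-/

noncomputable section

namespace Summit.AtomisticToContinuum.Crystallization.Theorems.ExcessDecayLiouville

open scoped BigOperators Topology Classical InnerProductSpace
open Literature.MathematicalPhysics.StatisticalMechanics
open Summit.AtomisticToContinuum.Crystallization.Theses.ExcessDecayLiouville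
open Summit.AtomisticToContinuum.Crystallization.Theorems.PhononStabilityNegative

section Chord

variable {t : Fin 2 → (EuclideanSpace ℝ (Fin 3))} {A : (EuclideanSpace ℝ (Fin 3)) →L[ℝ] (EuclideanSpace ℝ (Fin 3))} {u u₁ : (EuclideanSpace ℝ (Fin 3)) → (EuclideanSpace ℝ (Fin 3))} {c : (EuclideanSpace ℝ (Fin 3))} {R κ₁ : ℝ}


/-! ## The chords stay near the bonds -/

/-- **Chord bound**: for distinct sites `p, q` and `θ ∈ [0,1]`, `‖a_pq + θδ_pq‖ ≥ (9/10) dist p q`.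
[folklore] -/
private theorem chord_dist_le (hA : Adm₀ A) (hI : Inner₀ t A) (hu : ∀ s ∈ Sites₀ t A, ‖u s‖ ≤ 1 / 40)
    (hu₁ : ∀ s ∈ Sites₀ t A, ‖u₁ s‖ ≤ 1 / 40) {p q : (EuclideanSpace ℝ (Fin 3))} (hp : p ∈ Sites₀ t A) (hq : q ∈ Sites₀ t A)
    (hpq : p ≠ q) {θ : ℝ} (hθ : θ ∈ Set.Icc (0 : ℝ) 1) :
    9 / 10 * dist p q ≤ ‖((p : (EuclideanSpace ℝ (Fin 3))) + u p - ((q : (EuclideanSpace ℝ (Fin 3))) + u q)) + θ • ((u₁ p - u p) - (u₁ q - u q))‖ := by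
  have he : 23 / 25 ≤ ‖p - q‖ := by rw [← dist_eq_norm]; exact dist_sites_ge hA hI hp hq hpq
  have h₀ : ‖u p - u q‖ ≤ 1 / 20 := by
    have := norm_sub_le (u p) (u q); linarith [hu p hp, hu q hq]
  have h₁ : ‖u₁ p - u₁ q‖ ≤ 1 / 20 := by
    have := norm_sub_le (u₁ p) (u₁ q); linarith [hu₁ p hp, hu₁ q hq]
  have h := flatDiff_chord_norm_ge he h₀ h₁ hθ
  have e1 : (p - q + (u p - u q)) + θ • ((u₁ p - u₁ q) - (u p - u q)) = ((p : (EuclideanSpace ℝ (Fin 3))) + u p - ((q : (EuclideanSpace ℝ (Fin 3))) + u q)) + θ • ((u₁ p - u p) - (u₁ q - u q)) := by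
    module
  rwa [e1, ← dist_eq_norm] at h

/-- The chord avoids the origin. [folklore] -/
theorem flatDiff_chord_ne_zero (hA : Adm₀ A) (hI : Inner₀ t A) (hu : ∀ s ∈ Sites₀ t A, ‖u s‖ ≤ 1 / 40)
    (hu₁ : ∀ s ∈ Sites₀ t A, ‖u₁ s‖ ≤ 1 / 40) {p q : (EuclideanSpace ℝ (Fin 3))} (hp : p ∈ Sites₀ t A) (hq : q ∈ Sites₀ t A)
    (hpq : p ≠ q) {θ : ℝ} (hθ : θ ∈ Set.Icc (0 : ℝ) 1) : ((p : (EuclideanSpace ℝ (Fin 3))) + u p - ((q : (EuclideanSpace ℝ (Fin 3))) + u q)) + θ • ((u₁ p - u p) - (u₁ q - u q)) ≠ 0 := by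
  have h := chord_dist_le hA hI hu hu₁ hp hq hpq hθ
  have hd : 0 < dist p q := dist_pos.2 hpq
  intro h0
  rw [h0, norm_zero] at h
  linarith

/-! ## The dominating family -/

/-- Pointwise domination of the frozen force-constant forms along the chord by
`904(10/9)⁸ (dist p q)⁻⁸ ‖ξ‖²`. [folklore] -/
private theorem abs_Hess₀_chord_sites_le (hA : Adm₀ A) (hI : Inner₀ t A) (hu : ∀ s ∈ Sites₀ t A, ‖u s‖ ≤ 1 / 40)
    (hu₁ : ∀ s ∈ Sites₀ t A, ‖u₁ s‖ ≤ 1 / 40) {p q : (EuclideanSpace ℝ (Fin 3))} (hp : p ∈ Sites₀ t A) (hq : q ∈ Sites₀ t A)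
    (hpq : p ≠ q) {θ : ℝ} (hθ : θ ∈ Set.Icc (0 : ℝ) 1) (ξ : (EuclideanSpace ℝ (Fin 3))) :
    |Hess₀ (((p : (EuclideanSpace ℝ (Fin 3))) + u p - ((q : (EuclideanSpace ℝ (Fin 3))) + u q)) + θ • ((u₁ p - u p) - (u₁ q - u q))) ξ| ≤ 904 * (10 / 9) ^ 8 * (dist p q)⁻¹ ^ 8 * ‖ξ‖ ^ 2 := by
  have he : 23 / 25 ≤ ‖p - q‖ := by rw [← dist_eq_norm]; exact dist_sites_ge hA hI hp hq hpq
  have hch : 9 / 10 * ‖p - q‖ ≤ ‖((p : (EuclideanSpace ℝ (Fin 3))) + u p - ((q : (EuclideanSpace ℝ (Fin 3))) + u q)) + θ • ((u₁ p - u p) - (u₁ q - u q))‖ := by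
    rw [← dist_eq_norm]; exact chord_dist_le hA hI hu hu₁ hp hq hpq hθ
  have h := flatDiff_abs_Hess₀_chord_le ξ he hch
  rw [dist_eq_norm]
  exact h

/-- Domination of the secant forms by `904(10/9)⁸ (dist p q)⁻⁸ ‖ξ‖²`. [folklore] -/
theorem flatDiff_abs_secHess_sites_le (hA : Adm₀ A) (hI : Inner₀ t A) (hu : ∀ s ∈ Sites₀ t A, ‖u s‖ ≤ 1 / 40)
    (hu₁ : ∀ s ∈ Sites₀ t A, ‖u₁ s‖ ≤ 1 / 40) {p q : (EuclideanSpace ℝ (Fin 3))} (hp : p ∈ Sites₀ t A) (hq : q ∈ Sites₀ t A)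
    (hpq : p ≠ q) (ξ : (EuclideanSpace ℝ (Fin 3))) :
    |secHess (((p : (EuclideanSpace ℝ (Fin 3))) + u p - ((q : (EuclideanSpace ℝ (Fin 3))) + u q))) (((u₁ p - u p) - (u₁ q - u q))) ξ| ≤ 904 * (10 / 9) ^ 8 * (dist p q)⁻¹ ^ 8 * ‖ξ‖ ^ 2 := by
  have he : 23 / 25 ≤ ‖p - q‖ := by rw [← dist_eq_norm]; exact dist_sites_ge hA hI hp hq hpq
  have hch : ∀ θ ∈ Set.Icc (0 : ℝ) 1, 9 / 10 * ‖p - q‖ ≤ ‖((p : (EuclideanSpace ℝ (Fin 3))) + u p - ((q : (EuclideanSpace ℝ (Fin 3))) + u q)) + θ • ((u₁ p - u p) - (u₁ q - u q))‖ := by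
    intro θ hθ
    rw [← dist_eq_norm]; exact chord_dist_le hA hI hu hu₁ hp hq hpq hθ
  have h := flatDiff_abs_secHess_chord_le ξ he hch
  rw [dist_eq_norm]
  exact h

/-- The cut-off field vanishes at sites outside `B_{2R}(c)`. [folklore] -/
private theorem testField_eq_zero (hR : 0 < R) {x : (EuclideanSpace ℝ (Fin 3))} (hx : 2 * R ≤ dist x c) : (max 0 (min 1 (2 - dist (x : (EuclideanSpace ℝ (Fin 3))) c / R)) • (u₁ x - u x)) = 0 := by
  rw [flatDiff_cutoff_eq_zero hR hx, zero_smul]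

/-- **Summability of the dominating family** `904(10/9)⁸ (dist p q)⁻⁸ ‖φ p − φ q‖²` over `↥S × ↥S`
(`φ` is supported on the finitely many sites of `B_{2R}(c)`, and `Σ_q (dist p q)⁻⁸ < ∞`). [folklore] -/
private theorem summable_chordBound (hA : Adm₀ A) (hI : Inner₀ t A) (hR : 0 < R) :
    Summable (Function.uncurry fun p q : Sites₀ t A =>
      if (p : (EuclideanSpace ℝ (Fin 3))) ≠ q then 904 * (10 / 9) ^ 8 * (dist (p : (EuclideanSpace ℝ (Fin 3))) q)⁻¹ ^ 8 * ‖(max 0 (min 1 (2 - dist (p : (EuclideanSpace ℝ (Fin 3))) c / R)) • (u₁ p - u p)) - (max 0 (min 1 (2 - dist (q : (EuclideanSpace ℝ (Fin 3))) c / R)) • (u₁ q - u q))‖ ^ 2 else 0) := by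
  set F : Finset (Sites₀ t A) := (flatDiff_finite_sites_ball hA hI c (2 * R)).toFinset with hF
  have hF0 : ∀ p : Sites₀ t A, p ∉ F → (max 0 (min 1 (2 - dist (p : (EuclideanSpace ℝ (Fin 3))) c / R)) • (u₁ p - u p)) = 0 := by
    intro p hp
    apply testField_eq_zero hR
    by_contra h
    exact hp ((Set.Finite.mem_toFinset _).2 (le_of_lt (not_le.1 h)))
  -- the two one-sided majorants
  set B₁ : Sites₀ t A → Sites₀ t A → ℝ := fun p q =>
    (if (p : (EuclideanSpace ℝ (Fin 3))) ≠ q then (dist (p : (EuclideanSpace ℝ (Fin 3))) q)⁻¹ ^ (5 + 3) else 0) * (2 * (904 * (10 / 9) ^ 8) * ‖(max 0 (min 1 (2 - dist (p : (EuclideanSpace ℝ (Fin 3))) c / R)) • (u₁ p - u p))‖ ^ 2)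
    with hB₁
  set B₂ : Sites₀ t A → Sites₀ t A → ℝ := fun p q =>
    (if (q : (EuclideanSpace ℝ (Fin 3))) ≠ p then (dist (q : (EuclideanSpace ℝ (Fin 3))) p)⁻¹ ^ (5 + 3) else 0) * (2 * (904 * (10 / 9) ^ 8) * ‖(max 0 (min 1 (2 - dist (q : (EuclideanSpace ℝ (Fin 3))) c / R)) • (u₁ q - u q))‖ ^ 2)
    with hB₂
  have hS₁ : Summable (Function.uncurry B₁) := by
    refine flatDiff_summable_uncurry_of_left_finset B₁ F (fun p hp q => by simp [hB₁, hF0 p hp]) fun p _ => ?_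
    exact (flatDiff_summable_inv_pow_sites hA hI p.2 (show 1 ≤ 5 by norm_num)).1.mul_right _
  have hS₂ : Summable (Function.uncurry B₂) := by
    refine flatDiff_summable_uncurry_of_right_finset B₂ F (fun q hq p => by simp [hB₂, hF0 q hq]) fun q _ => ?_
    exact (flatDiff_summable_inv_pow_sites hA hI q.2 (show 1 ≤ 5 by norm_num)).1.mul_right _
  refine Summable.of_nonneg_of_le (fun pq => ?_) (fun pq => ?_) (hS₁.add hS₂)
  · obtain ⟨p, q⟩ := pq
    simp only [Function.uncurry_apply_pair]
    split_ifs <;> positivity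
  · obtain ⟨p, q⟩ := pq
    simp only [Function.uncurry_apply_pair, hB₁, hB₂]
    by_cases hpq : (p : (EuclideanSpace ℝ (Fin 3))) ≠ q
    · rw [if_pos hpq, if_pos hpq, if_pos (Ne.symm hpq), dist_comm (q : (EuclideanSpace ℝ (Fin 3))) p]
      have hsq : ‖(max 0 (min 1 (2 - dist (p : (EuclideanSpace ℝ (Fin 3))) c / R)) • (u₁ p - u p)) - (max 0 (min 1 (2 - dist (q : (EuclideanSpace ℝ (Fin 3))) c / R)) • (u₁ q - u q))‖ ^ 2 ≤ 2 * ‖(max 0 (min 1 (2 - dist (p : (EuclideanSpace ℝ (Fin 3))) c / R)) • (u₁ p - u p))‖ ^ 2 + 2 * ‖(max 0 (min 1 (2 - dist (q : (EuclideanSpace ℝ (Fin 3))) c / R)) • (u₁ q - u q))‖ ^ 2 := by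
        have h := parallelogram_law_with_norm ℝ ((max 0 (min 1 (2 - dist (p : (EuclideanSpace ℝ (Fin 3))) c / R)) • (u₁ p - u p))) ((max 0 (min 1 (2 - dist (q : (EuclideanSpace ℝ (Fin 3))) c / R)) • (u₁ q - u q)))
        nlinarith [sq_nonneg ‖(max 0 (min 1 (2 - dist (p : (EuclideanSpace ℝ (Fin 3))) c / R)) • (u₁ p - u p)) + (max 0 (min 1 (2 - dist (q : (EuclideanSpace ℝ (Fin 3))) c / R)) • (u₁ q - u q))‖]
      have h8 : (0 : ℝ) ≤ (dist (p : (EuclideanSpace ℝ (Fin 3))) q)⁻¹ ^ (5 + 3) := by positivity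
      have e8 : (dist (p : (EuclideanSpace ℝ (Fin 3))) q)⁻¹ ^ 8 = (dist (p : (EuclideanSpace ℝ (Fin 3))) q)⁻¹ ^ (5 + 3) := by norm_num
      rw [e8]
      nlinarith
    · rw [if_neg hpq, if_neg hpq, if_neg (fun h => hpq (Ne.symm h))]
      simp

/-! ## The frozen forms along the chords: summability, continuity -/

/-- The frozen force-constant forms `Hess₀ (a_pq + θδ_pq) (φ p − φ q)` (`θ ∈ [0,1]`) are dominated by the
summable family. [folklore] -/
private theorem abs_frozen_le (hA : Adm₀ A) (hI : Inner₀ t A) (hu : ∀ s ∈ Sites₀ t A, ‖u s‖ ≤ 1 / 40)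
    (hu₁ : ∀ s ∈ Sites₀ t A, ‖u₁ s‖ ≤ 1 / 40) {θ : ℝ} (hθ : θ ∈ Set.Icc (0 : ℝ) 1)
    (p q : Sites₀ t A) :
    ‖(if (p : (EuclideanSpace ℝ (Fin 3))) ≠ q then Hess₀ (((p : (EuclideanSpace ℝ (Fin 3))) + u p - ((q : (EuclideanSpace ℝ (Fin 3))) + u q)) + θ • ((u₁ p - u p) - (u₁ q - u q))) ((max 0 (min 1 (2 - dist (p : (EuclideanSpace ℝ (Fin 3))) c / R)) • (u₁ p - u p)) - (max 0 (min 1 (2 - dist (q : (EuclideanSpace ℝ (Fin 3))) c / R)) • (u₁ q - u q))) else 0)‖ ≤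
      (if (p : (EuclideanSpace ℝ (Fin 3))) ≠ q then 904 * (10 / 9) ^ 8 * (dist (p : (EuclideanSpace ℝ (Fin 3))) q)⁻¹ ^ 8 * ‖(max 0 (min 1 (2 - dist (p : (EuclideanSpace ℝ (Fin 3))) c / R)) • (u₁ p - u p)) - (max 0 (min 1 (2 - dist (q : (EuclideanSpace ℝ (Fin 3))) c / R)) • (u₁ q - u q))‖ ^ 2
        else 0) := by
  by_cases hpq : (p : (EuclideanSpace ℝ (Fin 3))) ≠ q
  · rw [if_pos hpq, if_pos hpq, Real.norm_eq_abs]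
    exact abs_Hess₀_chord_sites_le hA hI hu hu₁ p.2 q.2 hpq hθ _
  · rw [if_neg hpq, if_neg hpq, norm_zero]

/-- The secant forms `secHess a_pq δ_pq (φ p − φ q)` are dominated by the summable family. [folklore] -/
private theorem abs_secant_le (hA : Adm₀ A) (hI : Inner₀ t A) (hu : ∀ s ∈ Sites₀ t A, ‖u s‖ ≤ 1 / 40)
    (hu₁ : ∀ s ∈ Sites₀ t A, ‖u₁ s‖ ≤ 1 / 40) (p q : Sites₀ t A) :
    ‖(if (p : (EuclideanSpace ℝ (Fin 3))) ≠ q then secHess (((p : (EuclideanSpace ℝ (Fin 3))) + u p - ((q : (EuclideanSpace ℝ (Fin 3))) + u q))) (((u₁ p - u p) - (u₁ q - u q))) ((max 0 (min 1 (2 - dist (p : (EuclideanSpace ℝ (Fin 3))) c / R)) • (u₁ p - u p)) - (max 0 (min 1 (2 - dist (q : (EuclideanSpace ℝ (Fin 3))) c / R)) • (u₁ q - u q))) else 0)‖ ≤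
      (if (p : (EuclideanSpace ℝ (Fin 3))) ≠ q then 904 * (10 / 9) ^ 8 * (dist (p : (EuclideanSpace ℝ (Fin 3))) q)⁻¹ ^ 8 * ‖(max 0 (min 1 (2 - dist (p : (EuclideanSpace ℝ (Fin 3))) c / R)) • (u₁ p - u p)) - (max 0 (min 1 (2 - dist (q : (EuclideanSpace ℝ (Fin 3))) c / R)) • (u₁ q - u q))‖ ^ 2
        else 0) := by
  by_cases hpq : (p : (EuclideanSpace ℝ (Fin 3))) ≠ q
  · rw [if_pos hpq, if_pos hpq, Real.norm_eq_abs]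
    exact flatDiff_abs_secHess_sites_le hA hI hu hu₁ p.2 q.2 hpq _
  · rw [if_neg hpq, if_neg hpq, norm_zero]

/-- Summability over `↥S × ↥S` of the frozen forms, for each `θ ∈ [0,1]`. [folklore] -/
private theorem summable_frozen (hA : Adm₀ A) (hI : Inner₀ t A) (hu : ∀ s ∈ Sites₀ t A, ‖u s‖ ≤ 1 / 40)
    (hu₁ : ∀ s ∈ Sites₀ t A, ‖u₁ s‖ ≤ 1 / 40) (hR : 0 < R) {θ : ℝ} (hθ : θ ∈ Set.Icc (0 : ℝ) 1) :
    Summable (Function.uncurry fun p q : Sites₀ t A =>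
      if (p : (EuclideanSpace ℝ (Fin 3))) ≠ q then Hess₀ (((p : (EuclideanSpace ℝ (Fin 3))) + u p - ((q : (EuclideanSpace ℝ (Fin 3))) + u q)) + θ • ((u₁ p - u p) - (u₁ q - u q))) ((max 0 (min 1 (2 - dist (p : (EuclideanSpace ℝ (Fin 3))) c / R)) • (u₁ p - u p)) - (max 0 (min 1 (2 - dist (q : (EuclideanSpace ℝ (Fin 3))) c / R)) • (u₁ q - u q))) else 0) :=
  (summable_chordBound hA hI hR).of_norm_bounded fun pq => abs_frozen_le hA hI hu hu₁ hθ pq.1 pq.2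

/-- Summability over `↥S × ↥S` of the secant forms. [folklore] -/
theorem flatDiff_summable_secant (hA : Adm₀ A) (hI : Inner₀ t A) (hu : ∀ s ∈ Sites₀ t A, ‖u s‖ ≤ 1 / 40)
    (hu₁ : ∀ s ∈ Sites₀ t A, ‖u₁ s‖ ≤ 1 / 40) (hR : 0 < R) :
    Summable (Function.uncurry fun p q : Sites₀ t A =>
      if (p : (EuclideanSpace ℝ (Fin 3))) ≠ q then secHess (((p : (EuclideanSpace ℝ (Fin 3))) + u p - ((q : (EuclideanSpace ℝ (Fin 3))) + u q))) (((u₁ p - u p) - (u₁ q - u q))) ((max 0 (min 1 (2 - dist (p : (EuclideanSpace ℝ (Fin 3))) c / R)) • (u₁ p - u p)) - (max 0 (min 1 (2 - dist (q : (EuclideanSpace ℝ (Fin 3))) c / R)) • (u₁ q - u q))) else 0) :=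
  (summable_chordBound hA hI hR).of_norm_bounded fun pq => abs_secant_le hA hI hu hu₁ pq.1 pq.2

/-- Continuity in `θ ∈ [0,1]` of each frozen form. [folklore] -/
private theorem continuousOn_frozen (hA : Adm₀ A) (hI : Inner₀ t A) (hu : ∀ s ∈ Sites₀ t A, ‖u s‖ ≤ 1 / 40)
    (hu₁ : ∀ s ∈ Sites₀ t A, ‖u₁ s‖ ≤ 1 / 40) (p q : Sites₀ t A) :
    ContinuousOn (fun θ : ℝ =>
      if (p : (EuclideanSpace ℝ (Fin 3))) ≠ q then Hess₀ (((p : (EuclideanSpace ℝ (Fin 3))) + u p - ((q : (EuclideanSpace ℝ (Fin 3))) + u q)) + θ • ((u₁ p - u p) - (u₁ q - u q))) ((max 0 (min 1 (2 - dist (p : (EuclideanSpace ℝ (Fin 3))) c / R)) • (u₁ p - u p)) - (max 0 (min 1 (2 - dist (q : (EuclideanSpace ℝ (Fin 3))) c / R)) • (u₁ q - u q))) else 0) (Set.Icc 0 1) := by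
  by_cases hpq : (p : (EuclideanSpace ℝ (Fin 3))) ≠ q
  · simp only [if_pos hpq]
    exact fun θ hθ => (flatDiff_continuousAt_Hess₀_chord _ _ _
      (flatDiff_chord_ne_zero hA hI hu hu₁ p.2 q.2 hpq hθ)).continuousWithinAt
  · simp only [if_neg hpq]
    exact continuousOn_const

/-- **Dominated convergence**: the secant forms sum to the `θ`-integral of the sums of the frozen
forms. [folklore] -/
private theorem hasSum_secForm (hA : Adm₀ A) (hI : Inner₀ t A) (hu : ∀ s ∈ Sites₀ t A, ‖u s‖ ≤ 1 / 40)
    (hu₁ : ∀ s ∈ Sites₀ t A, ‖u₁ s‖ ≤ 1 / 40) (hR : 0 < R) :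
    HasSum (Function.uncurry fun p q : Sites₀ t A =>
        if (p : (EuclideanSpace ℝ (Fin 3))) ≠ q then secHess (((p : (EuclideanSpace ℝ (Fin 3))) + u p - ((q : (EuclideanSpace ℝ (Fin 3))) + u q))) (((u₁ p - u p) - (u₁ q - u q))) ((max 0 (min 1 (2 - dist (p : (EuclideanSpace ℝ (Fin 3))) c / R)) • (u₁ p - u p)) - (max 0 (min 1 (2 - dist (q : (EuclideanSpace ℝ (Fin 3))) c / R)) • (u₁ q - u q))) else 0)
      (∫ θ in (0 : ℝ)..1, ∑' pq : Sites₀ t A × Sites₀ t A,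
        (if (pq.1 : (EuclideanSpace ℝ (Fin 3))) ≠ pq.2 then
          Hess₀ (((pq.1 : (EuclideanSpace ℝ (Fin 3))) + u pq.1 - ((pq.2 : (EuclideanSpace ℝ (Fin 3))) + u pq.2)) + θ • ((u₁ pq.1 - u pq.1) - (u₁ pq.2 - u pq.2))) ((max 0 (min 1 (2 - dist (pq.1 : (EuclideanSpace ℝ (Fin 3))) c / R)) • (u₁ pq.1 - u pq.1)) - (max 0 (min 1 (2 - dist (pq.2 : (EuclideanSpace ℝ (Fin 3))) c / R)) • (u₁ pq.2 - u pq.2))) else 0)) := by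
  haveI : Countable (Sites₀ t A) := (flatDiff_countable_sites₀ t A).to_subtype
  have h := intervalIntegral.hasSum_integral_of_dominated_convergence (μ := MeasureTheory.volume)
    (a := (0 : ℝ)) (b := 1)
    (F := fun (pq : Sites₀ t A × Sites₀ t A) (θ : ℝ) => if (pq.1 : (EuclideanSpace ℝ (Fin 3))) ≠ pq.2 then
      Hess₀ (((pq.1 : (EuclideanSpace ℝ (Fin 3))) + u pq.1 - ((pq.2 : (EuclideanSpace ℝ (Fin 3))) + u pq.2)) + θ • ((u₁ pq.1 - u pq.1) - (u₁ pq.2 - u pq.2))) ((max 0 (min 1 (2 - dist (pq.1 : (EuclideanSpace ℝ (Fin 3))) c / R)) • (u₁ pq.1 - u pq.1)) - (max 0 (min 1 (2 - dist (pq.2 : (EuclideanSpace ℝ (Fin 3))) c / R)) • (u₁ pq.2 - u pq.2))) else 0)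
    (f := fun θ : ℝ => ∑' pq : Sites₀ t A × Sites₀ t A, (if (pq.1 : (EuclideanSpace ℝ (Fin 3))) ≠ pq.2 then
      Hess₀ (((pq.1 : (EuclideanSpace ℝ (Fin 3))) + u pq.1 - ((pq.2 : (EuclideanSpace ℝ (Fin 3))) + u pq.2)) + θ • ((u₁ pq.1 - u pq.1) - (u₁ pq.2 - u pq.2))) ((max 0 (min 1 (2 - dist (pq.1 : (EuclideanSpace ℝ (Fin 3))) c / R)) • (u₁ pq.1 - u pq.1)) - (max 0 (min 1 (2 - dist (pq.2 : (EuclideanSpace ℝ (Fin 3))) c / R)) • (u₁ pq.2 - u pq.2))) else 0))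
    (fun pq _ => if (pq.1 : (EuclideanSpace ℝ (Fin 3))) ≠ pq.2 then
      904 * (10 / 9) ^ 8 * (dist (pq.1 : (EuclideanSpace ℝ (Fin 3))) pq.2)⁻¹ ^ 8 * ‖(max 0 (min 1 (2 - dist (pq.1 : (EuclideanSpace ℝ (Fin 3))) c / R)) • (u₁ pq.1 - u pq.1)) - (max 0 (min 1 (2 - dist (pq.2 : (EuclideanSpace ℝ (Fin 3))) c / R)) • (u₁ pq.2 - u pq.2))‖ ^ 2 else 0)
    ?_ ?_ ?_ ?_ ?_
  · refine h.congr_fun fun pq => ?_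
    obtain ⟨p, q⟩ := pq
    simp only [Function.uncurry_apply_pair]
    by_cases hpq : (p : (EuclideanSpace ℝ (Fin 3))) ≠ q
    · simp only [if_pos hpq]
      rfl
    · simp only [if_neg hpq, intervalIntegral.integral_zero]
  · intro pq
    rw [Set.uIoc_of_le zero_le_one]
    exact ((continuousOn_frozen hA hI hu hu₁ pq.1 pq.2).mono Set.Ioc_subset_Icc_self).aestronglyMeasurable
      measurableSet_Ioc
  · intro pq
    refine MeasureTheory.ae_of_all _ fun θ hθ => ?_
    rw [Set.uIoc_of_le zero_le_one] at hθ
    exact abs_frozen_le hA hI hu hu₁ (Set.Ioc_subset_Icc_self hθ) pq.1 pq.2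
  · exact MeasureTheory.ae_of_all _ fun θ _ => summable_chordBound hA hI hR
  · exact intervalIntegrable_const
  · refine MeasureTheory.ae_of_all _ fun θ hθ => ?_
    rw [Set.uIoc_of_le zero_le_one] at hθ
    exact (summable_frozen hA hI hu hu₁ hR (Set.Ioc_subset_Icc_self hθ)).hasSum

/-- Continuity in `θ ∈ [0,1]` of the summed frozen forms (Weierstrass M-test). [folklore] -/
private theorem continuousOn_tsum_frozen (hA : Adm₀ A) (hI : Inner₀ t A) (hu : ∀ s ∈ Sites₀ t A, ‖u s‖ ≤ 1 / 40)
    (hu₁ : ∀ s ∈ Sites₀ t A, ‖u₁ s‖ ≤ 1 / 40) (hR : 0 < R) :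
    ContinuousOn (fun θ : ℝ => ∑' pq : Sites₀ t A × Sites₀ t A,
      (if (pq.1 : (EuclideanSpace ℝ (Fin 3))) ≠ pq.2 then
        Hess₀ (((pq.1 : (EuclideanSpace ℝ (Fin 3))) + u pq.1 - ((pq.2 : (EuclideanSpace ℝ (Fin 3))) + u pq.2)) + θ • ((u₁ pq.1 - u pq.1) - (u₁ pq.2 - u pq.2))) ((max 0 (min 1 (2 - dist (pq.1 : (EuclideanSpace ℝ (Fin 3))) c / R)) • (u₁ pq.1 - u pq.1)) - (max 0 (min 1 (2 - dist (pq.2 : (EuclideanSpace ℝ (Fin 3))) c / R)) • (u₁ pq.2 - u pq.2))) else 0)) (Set.Icc 0 1) :=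
  continuousOn_tsum (fun pq => continuousOn_frozen hA hI hu hu₁ pq.1 pq.2) (summable_chordBound hA hI hR)
    fun pq _ hθ => abs_frozen_le hA hI hu hu₁ hθ pq.1 pq.2

/-! ## Box coercivity along the chord, integrated -/

/-- The configuration `u + θw` lies in the `1/40`-box for `θ ∈ [0,1]`. [folklore] -/
private theorem norm_chordConfig_le (hu : ∀ s ∈ Sites₀ t A, ‖u s‖ ≤ 1 / 40)
    (hu₁ : ∀ s ∈ Sites₀ t A, ‖u₁ s‖ ≤ 1 / 40) {θ : ℝ} (hθ : θ ∈ Set.Icc (0 : ℝ) 1) :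
    ∀ s ∈ Sites₀ t A, ‖u s + θ • (u₁ s - u s)‖ ≤ 1 / 40 := by
  intro s hs
  have hsplit : u s + θ • (u₁ s - u s) = (1 - θ) • u s + θ • u₁ s := by module
  rw [hsplit]
  have h1 : ‖(1 - θ) • u s‖ ≤ (1 - θ) * (1 / 40) := by
    rw [norm_smul, Real.norm_eq_abs, abs_of_nonneg (by linarith [hθ.2])]
    exact mul_le_mul_of_nonneg_left (hu s hs) (by linarith [hθ.2])
  have h2 : ‖θ • u₁ s‖ ≤ θ * (1 / 40) := by
    rw [norm_smul, Real.norm_eq_abs, abs_of_nonneg hθ.1]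
    exact mul_le_mul_of_nonneg_left (hu₁ s hs) hθ.1
  calc ‖(1 - θ) • u s + θ • u₁ s‖ ≤ ‖(1 - θ) • u s‖ + ‖θ • u₁ s‖ := norm_add_le _ _
    _ ≤ (1 - θ) * (1 / 40) + θ * (1 / 40) := add_le_add h1 h2
    _ = 1 / 40 := by ring

/-- The test field extended by zero off the sites is finitely supported inside the sites. [folklore] -/
theorem flatDiff_support_testField (hA : Adm₀ A) (hI : Inner₀ t A) (hR : 0 < R) :
    (Function.support fun x : (EuclideanSpace ℝ (Fin 3)) => if x ∈ Sites₀ t A then (max 0 (min 1 (2 - dist (x : (EuclideanSpace ℝ (Fin 3))) c / R)) • (u₁ x - u x)) else 0).Finite ∧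
      (Function.support fun x : (EuclideanSpace ℝ (Fin 3)) => if x ∈ Sites₀ t A then (max 0 (min 1 (2 - dist (x : (EuclideanSpace ℝ (Fin 3))) c / R)) • (u₁ x - u x)) else 0) ⊆ Sites₀ t A := by
  have hsub : (Function.support fun x : (EuclideanSpace ℝ (Fin 3)) => if x ∈ Sites₀ t A then (max 0 (min 1 (2 - dist (x : (EuclideanSpace ℝ (Fin 3))) c / R)) • (u₁ x - u x)) else 0) ⊆
      {s : (EuclideanSpace ℝ (Fin 3)) | s ∈ Sites₀ t A ∧ dist s c ≤ 2 * R} := by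
    intro x hx
    rw [Function.mem_support] at hx
    by_cases hxS : x ∈ Sites₀ t A
    · refine ⟨hxS, ?_⟩
      by_contra hfar
      exact hx (by rw [if_pos hxS, testField_eq_zero hR (le_of_lt (not_le.1 hfar))])
    · exact (hx (by rw [if_neg hxS])).elim
  exact ⟨(finite_sites_dist_le hA hI c (2 * R)).subset hsub, fun x hx => (hsub hx).1⟩

/-- **The box inequality along the chord**: for `θ ∈ [0,1]`,
`2κ₁ · nnForm t A φ ≤ Σ_{(p,q)} Hess₀ (a_pq + θδ_pq) (φ p − φ q)`. [folklore] -/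
private theorem coercive_frozen (hA : Adm₀ A) (hI : Inner₀ t A) (hBox : BoxCoercive (1 / 40) κ₁)
    (hu : ∀ s ∈ Sites₀ t A, ‖u s‖ ≤ 1 / 40) (hu₁ : ∀ s ∈ Sites₀ t A, ‖u₁ s‖ ≤ 1 / 40) (hR : 0 < R)
    {θ : ℝ} (hθ : θ ∈ Set.Icc (0 : ℝ) 1) :
    2 * κ₁ * nnForm t A (fun x : (EuclideanSpace ℝ (Fin 3)) => if x ∈ Sites₀ t A then (max 0 (min 1 (2 - dist (x : (EuclideanSpace ℝ (Fin 3))) c / R)) • (u₁ x - u x)) else 0) ≤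
      ∑' pq : Sites₀ t A × Sites₀ t A, (if (pq.1 : (EuclideanSpace ℝ (Fin 3))) ≠ pq.2 then
        Hess₀ (((pq.1 : (EuclideanSpace ℝ (Fin 3))) + u pq.1 - ((pq.2 : (EuclideanSpace ℝ (Fin 3))) + u pq.2)) + θ • ((u₁ pq.1 - u pq.1) - (u₁ pq.2 - u pq.2))) ((max 0 (min 1 (2 - dist (pq.1 : (EuclideanSpace ℝ (Fin 3))) c / R)) • (u₁ pq.1 - u pq.1)) - (max 0 (min 1 (2 - dist (pq.2 : (EuclideanSpace ℝ (Fin 3))) c / R)) • (u₁ pq.2 - u pq.2))) else 0) := by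
  obtain ⟨hfin, hsub⟩ := flatDiff_support_testField hA hI hR (u := u) (u₁ := u₁)
  have hB := hBox t A hA hI (fun x => u x + θ • (u₁ x - u x)) (norm_chordConfig_le hu hu₁ hθ)
    (fun x : (EuclideanSpace ℝ (Fin 3)) => if x ∈ Sites₀ t A then (max 0 (min 1 (2 - dist (x : (EuclideanSpace ℝ (Fin 3))) c / R)) • (u₁ x - u x)) else 0) hfin hsub
  have hsum := summable_frozen (c := c) hA hI hu hu₁ hR hθ
  have hform : hessFormAt t A (fun x => u x + θ • (u₁ x - u x))
      (fun x : (EuclideanSpace ℝ (Fin 3)) => if x ∈ Sites₀ t A then (max 0 (min 1 (2 - dist (x : (EuclideanSpace ℝ (Fin 3))) c / R)) • (u₁ x - u x)) else 0) =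
      ∑' p : Sites₀ t A, ∑' q : Sites₀ t A, (if (p : (EuclideanSpace ℝ (Fin 3))) ≠ q then
        Hess₀ (((p : (EuclideanSpace ℝ (Fin 3))) + u p - ((q : (EuclideanSpace ℝ (Fin 3))) + u q)) + θ • ((u₁ p - u p) - (u₁ q - u q))) ((max 0 (min 1 (2 - dist (p : (EuclideanSpace ℝ (Fin 3))) c / R)) • (u₁ p - u p)) - (max 0 (min 1 (2 - dist (q : (EuclideanSpace ℝ (Fin 3))) c / R)) • (u₁ q - u q))) else 0) := by
    unfold hessFormAt
    refine tsum_congr fun p => tsum_congr fun q => ?_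
    simp only [if_pos p.2, if_pos q.2]
    by_cases hpq : (p : (EuclideanSpace ℝ (Fin 3))) ≠ q
    · rw [if_pos hpq, if_pos hpq]
      congr 1
      module
    · rw [if_neg hpq, if_neg hpq]
  calc 2 * κ₁ * nnForm t A (fun x : (EuclideanSpace ℝ (Fin 3)) => if x ∈ Sites₀ t A then (max 0 (min 1 (2 - dist (x : (EuclideanSpace ℝ (Fin 3))) c / R)) • (u₁ x - u x)) else 0)
      ≤ hessFormAt t A (fun x => u x + θ • (u₁ x - u x))
          (fun x : (EuclideanSpace ℝ (Fin 3)) => if x ∈ Sites₀ t A then (max 0 (min 1 (2 - dist (x : (EuclideanSpace ℝ (Fin 3))) c / R)) • (u₁ x - u x)) else 0) := by linarith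
    _ = _ := hform
    _ = ∑' pq : Sites₀ t A × Sites₀ t A, Function.uncurry (fun p q : Sites₀ t A =>
          (if (p : (EuclideanSpace ℝ (Fin 3))) ≠ q then Hess₀ (((p : (EuclideanSpace ℝ (Fin 3))) + u p - ((q : (EuclideanSpace ℝ (Fin 3))) + u q)) + θ • ((u₁ p - u p) - (u₁ q - u q))) ((max 0 (min 1 (2 - dist (p : (EuclideanSpace ℝ (Fin 3))) c / R)) • (u₁ p - u p)) - (max 0 (min 1 (2 - dist (q : (EuclideanSpace ℝ (Fin 3))) c / R)) • (u₁ q - u q))) else 0)) pq :=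
        (hsum.tsum_prod_uncurry fun p => hsum.prod_factor p).symm
    _ = _ := rfl

/-- **Chord coercivity, integrated**: if `BoxCoercive (1/40) κ₁`, then for two `1/40`-bounded
displacements `u, u₁` of the sites of an admissible hcp datum and the cut-off test field `φ = χ·(u₁ − u)`,
`2κ₁ · nnForm t A φ ≤ Σ_{(p,q)} secHess a_pq δ_pq (φ p − φ q)`. [folklore] -/
theorem flatDiff_coercive_integrated (hA : Adm₀ A) (hI : Inner₀ t A) (hBox : BoxCoercive (1 / 40) κ₁)
    (hu : ∀ s ∈ Sites₀ t A, ‖u s‖ ≤ 1 / 40) (hu₁ : ∀ s ∈ Sites₀ t A, ‖u₁ s‖ ≤ 1 / 40) (hR : 0 < R) :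
    2 * κ₁ * nnForm t A (fun x : (EuclideanSpace ℝ (Fin 3)) => if x ∈ Sites₀ t A then (max 0 (min 1 (2 - dist (x : (EuclideanSpace ℝ (Fin 3))) c / R)) • (u₁ x - u x)) else 0) ≤
      ∑' pq : Sites₀ t A × Sites₀ t A, (if (pq.1 : (EuclideanSpace ℝ (Fin 3))) ≠ pq.2 then
        secHess (((pq.1 : (EuclideanSpace ℝ (Fin 3))) + u pq.1 - ((pq.2 : (EuclideanSpace ℝ (Fin 3))) + u pq.2))) (((u₁ pq.1 - u pq.1) - (u₁ pq.2 - u pq.2))) ((max 0 (min 1 (2 - dist (pq.1 : (EuclideanSpace ℝ (Fin 3))) c / R)) • (u₁ pq.1 - u pq.1)) - (max 0 (min 1 (2 - dist (pq.2 : (EuclideanSpace ℝ (Fin 3))) c / R)) • (u₁ pq.2 - u pq.2))) else 0) := by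
  have hL := hasSum_secForm (c := c) hA hI hu hu₁ hR
  rw [show (∑' pq : Sites₀ t A × Sites₀ t A, (if (pq.1 : (EuclideanSpace ℝ (Fin 3))) ≠ pq.2 then
        secHess (((pq.1 : (EuclideanSpace ℝ (Fin 3))) + u pq.1 - ((pq.2 : (EuclideanSpace ℝ (Fin 3))) + u pq.2))) (((u₁ pq.1 - u pq.1) - (u₁ pq.2 - u pq.2))) ((max 0 (min 1 (2 - dist (pq.1 : (EuclideanSpace ℝ (Fin 3))) c / R)) • (u₁ pq.1 - u pq.1)) - (max 0 (min 1 (2 - dist (pq.2 : (EuclideanSpace ℝ (Fin 3))) c / R)) • (u₁ pq.2 - u pq.2))) else 0)) = _ from hL.tsum_eq]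
  have hcont := continuousOn_tsum_frozen (c := c) hA hI hu hu₁ hR
  have hmono := intervalIntegral.integral_mono_on (μ := MeasureTheory.volume) zero_le_one
    intervalIntegrable_const
    (hcont.intervalIntegrable_of_Icc zero_le_one)
    (fun θ hθ => coercive_frozen hA hI hBox hu hu₁ hR hθ)
  rwa [intervalIntegral.integral_const, sub_zero, one_smul] at hmono

/-- Registered form of `flatDiff_coercive_integrated` (sub-goal of crux stmt-AtomisticToContinuum-9332, line
`Sketch`): chord coercivity integrated over `θ ∈ [0,1]`. [folklore] -/
theorem hcpLiouville_coercive_integrated : ∀ (κ₁ : ℝ) (t : Fin 2 → (EuclideanSpace ℝ (Fin 3))) (A : (EuclideanSpace ℝ (Fin 3)) →L[ℝ] (EuclideanSpace ℝ (Fin 3))) (u u₁ : (EuclideanSpace ℝ (Fin 3)) → (EuclideanSpace ℝ (Fin 3))) (c : (EuclideanSpace ℝ (Fin 3))) (R : ℝ), Adm₀ A → Inner₀ t A → BoxCoercive (1 / 40) κ₁ → (∀ s ∈ Sites₀ t A, ‖u s‖ ≤ 1 / 40) → (∀ s ∈ Sites₀ t A, ‖u₁ s‖ ≤ 1 / 40)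 → 0 < R → 2 * κ₁ * nnForm t A (fun x : (EuclideanSpace ℝ (Fin 3)) => if x ∈ Sites₀ t A then max 0 (min 1 (2 - dist x c / R)) • (u₁ x - u x) else 0) ≤ ∑' pq : Sites₀ t A × Sites₀ t A, (if (pq.1 : (EuclideanSpace ℝ (Fin 3))) ≠ pq.2 then secHess ((pq.1 : (EuclideanSpace ℝ (Fin 3))) + u pq.1 - ((pq.2 : (EuclideanSpace ℝ (Fin 3))) + u pq.2)) ((u₁ pq.1 - u pq.1) - (u₁ pq.2 - u pq.2)) (max 0 (min 1 (2 - dist (pq.1 : (EuclideanSpace ℝ (Fin 3))) c / R)) • (u₁ pq.1 - u pq.1) - max 0 (min 1 (2 - dist (pq.2 : (EuclideanSpace ℝ (Fin 3))) c / R)) • (u₁ pq.2 - u pq.2)) else 0) := by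
  intro κ₁ t A u u₁ c R hA hI hBox hu hu₁ hR
  exact flatDiff_coercive_integrated hA hI hBox hu hu₁ hR

end Chord

end Summit.AtomisticToContinuum.Crystallization.Theorems.ExcessDecayLiouville

end
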